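import Summits.QuantumFields.YangMills.Theorems.FluctuationComparisonRegPrIntLSupTailCoverUnion
import Summits.QuantumFields.YangMills.Theorems.FluctuationComparisonRegPrIntLSupTailReductionInt
import HarnessLib

/-!
# `FluctuationComparisonRegPrIntLSupTailCoverUnionDepthOne` — THE DEPTH-ONE EDITIONS OF THE UNION GLUE, FULL AND INTERIOR WINDOW: fine-level pinned rows with Bałaban's
# profile ⇒ TAILSUP₁ `WindowOddsSupDepthOneCan` (LINE g21-1) and ⇒ TAILSUP₁∘ `WindowOddsSupDepthOneIntCan` (LINE g21-2 v1.4, the live row after R3-FLIN), texts verbatim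
# (crux `UnitScaleTilt.FluctuationComparisonRegPrIntL`, stmt-QuantumFields-20520; companion of ✓L `…SupTailCoverUnion` and ✓K `…SupTailReductionInt`)

Cell `ym3-torus` (YM ladder rung R3 = continuum SU(2) Yang–Mills on T³ — a RUNG, NOT the Clay problem: not d = 4, not infinite volume, not a mass gap);
width seat `ym-ust-20520-w3` (gen 17); helper `--supports stmt-QuantumFields-20520`.  THEOREMS ONLY (0 `def`, 0 `sorry`, default heartbeats).

WHAT.  At depth one (`K = J + 1`) the only constrained level above the window is the FINE level `J + 1` itself, so the pinned events are events of the fine field's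
own plaquettes `{θ_{J+1} ≤ dist1(U(∂p))}` (`descendTo_self`) — exactly the currency of LINE g21-2's pinned rows PPT ∕ FPT (and of ✓E ∕ ✓G ∕ ✓H's row doors).
* §1 `preimage_diff_histGood_subset_fine` (the depth-one cover) · ★★`condGoodOddsDepthOne_of_pinnedRowsFine` — fine-level pinned rows `Gibbs_{J+1}(D⁻¹B ∩ {θ_{J+1} ≤ dist1(U(∂p))})
  ≤ ofReal(σ_p)·Gibbs_{J+1}(D⁻¹B ∩ histGood θ (J+1) J)` for `B` inside ANY sub-window `W ⊆ {PlaqSmall (θ J)}` ⇒ COND-ODDS at `(J, J+1)` with `e^τ = 1 + Σ_p σ_p`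
  (thresholds `θ`, window `W`, coupling free — interior windows included).
* §2 `sum_pinnedProfile_fine_le` (`Σ_{p∈T_{J+1}} C β_{J+1}^A e^{−c·pFun(g_{J+1})²} ≤ A'·2^{−J}`) · ★★★`condGoodOddsDepthOne_of_pinnedProfileFine : ⟨PINNED-PROFILE₁⟩ → ✓A's ⟨COND-ODDS₁⟩`
  · ★★★`windowOddsSupDepthOne_of_pinnedProfileFine : ⟨PINNED-PROFILE₁⟩ → TAILSUP₁ verbatim` (∘ ✓A `windowOddsSupDepthOneCan_of_condGoodOddsDepthOne`).
* §3 (interior window, the live edition) ★★★`condGoodOddsDepthOneInt_of_pinnedProfileFineInt : ⟨PINNED-PROFILE₁∘⟩ → ✓K's ⟨COND-ODDS₁∘⟩` (window `θBal L γ (c·b₀) p₀ J` inside the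
  history's `θBal L γ b₀ p₀ J` by lit `θBal_mul_le`, `c ≤ c₀ ≤ 1`, `γ ≤ 1`) · ★★★`windowOddsSupDepthOneInt_of_pinnedProfileFineInt : ⟨PINNED-PROFILE₁∘⟩ → TAILSUP₁∘
  `WindowOddsSupDepthOneIntCan` verbatim` (∘ ✓K).
HONEST SCOPE.  Measure arithmetic; the fine-level pinned rows are the HYPOTHESIS (PPT∘ ∕ FPT of LINE g21-2; their analytic content — chart, convexity one level deep, far
plaquette cost — is ✓E–✓I's input side and NOT supplied here); TAILSUP₁, TAILSUP₁∘, MOD₁∘, LFR♯ᶜ∘, S2β, 20520, `YM3TorusSU2` NOT proved; the Yang–Mills mass gap is NOT proved.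
References: [Balaban1985UV3] (2) p. 256, (7) p. 257, (38)–(40) p. 266, (71) p. 273.
-/

noncomputable section

set_option autoImplicit false

open MeasureTheory Filter Topology Set
open scoped ENNReal NNReal BigOperators
open Literature.MathematicalPhysics.QuantumFieldTheory.Balaban1983to89
open Literature.MathematicalPhysics.QuantumFieldTheory.Balaban1983to89.T3ContinuumYM3Torus
open Literature.MathematicalPhysics.QuantumFieldTheory.Balaban1983to89.T3NestedUnitLaws
open Literature.MathematicalPhysics.QuantumFieldTheory.Balaban1983to89.T3UnitLawDensityEML
open Literature.MathematicalPhysics.QuantumFieldTheory.Balaban1983to89.T3UnitScaleTilt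
open Literature.MathematicalPhysics.QuantumFieldTheory.Balaban1983to89.T3TiltDescent
open Literature.MathematicalPhysics.QuantumFieldTheory.Balaban1983to89.Missing
open scoped Literature.MathematicalPhysics.QuantumFieldTheory.Balaban1983to89.T3OrbitAverage
open Summit.QuantumFields.YangMills.Theorems.FluctuationComparisonRegPrIntLWregGlue (heightDensityCan)
open Summit.QuantumFields.YangMills.Theorems.FluctuationComparisonRegPrIntLSupTailCoverUnion

namespace Summit.QuantumFields.YangMills.Theorems.FluctuationComparisonRegPrIntLSupTailCoverUnionDepthOne

/-! ## §1 Depth one: the cover by the fine field's own plaquettes, and COND-ODDS at `(J, J+1)` from fine-level pinned rows -/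

section DepthOne

variable (F : T3Family) (γ : ℝ) (θ : ℕ → ℝ) (J : ℕ)

/-- **THE DEPTH-ONE COVER**: for `B` inside the level-`J` window `{PlaqSmall (θ J)}`, a fine field `U ∈ T_{J+1}` above `B` with a bad history has a plaquette `p` of the
fine lattice with `θ_{J+1} ≤ dist1(U(∂p))` (the only other constrained level is `J + 1`, where `D_{J+1,J+1} = id` by lit `descendTo_self`). [cite: Balaban1985UV3, (7) p.257] -/
theorem preimage_diff_histGood_subset_fine {B : Set (GaugeField (F.P J) 0 (Matrix.specialUnitaryGroup (Fin 2) ℂ))} (hBJ : B ⊆ {U | PlaqSmall (θ J) U}) :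
    descendTo F ℰp J (J + 1) (Nat.le_succ J) ⁻¹' B \ histGood F ℰp θ (J + 1) J ⊆
      ⋃ p ∈ (Finset.univ : Finset (Plaq (F.P (J + 1)) 0)),
        {U | θ (J + 1) ≤ dist1 (GaugeField.plaqHol U p)} := by
  rintro U ⟨hUB, hUG⟩
  rw [Set.mem_preimage] at hUB
  rw [FluctuationComparisonRegPrIntLSupTailDepthInduction.mem_histGood_iff_descendTo] at hUG
  simp only [not_forall] at hUG
  obtain ⟨j, hJj, hjK, hbad⟩ := hUG
  have hne : j ≠ J := by
    rintro rfl
    exact hbad (hBJ hUB)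
  have hj : j = J + 1 := by omega
  subst hj
  rw [T3DescentFibreTower.descendTo_self] at hbad
  simp only [PlaqSmall, not_forall, not_lt] at hbad
  obtain ⟨p, hp⟩ := hbad
  simp only [Set.mem_iUnion, Finset.mem_univ, exists_true_left, Set.mem_setOf_eq]
  exact ⟨p, hp⟩

/-- ★★ **COND-ODDS AT `(J, J+1)` ⟸ FINE-LEVEL PINNED ROWS**: if for every plaquette `p` of the fine lattice `T_{J+1}` the pinned bad event is dominated by the good mass above
`B`, `Gibbs_{J+1}(D⁻¹B ∩ {θ_{J+1} ≤ dist1(U(∂p))}) ≤ ofReal(σ_p)·Gibbs_{J+1}(D⁻¹B ∩ histGood θ (J+1) J)` (`σ ≥ 0`), and `B` lies inside the level-`J` window `{PlaqSmall (θ J)}`,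
then `Gibbs_{J+1}(D⁻¹B) ≤ ofReal(exp(log(1 + Σ_p σ_p)))·Gibbs_{J+1}(D⁻¹B ∩ histGood θ (J+1) J)` (✓L `condGoodOdds_of_regimeCover` on the depth-one cover). [cite: Balaban1985UV3, (7) p.257 and (38)-(40) p.266] -/
theorem condGoodOddsDepthOne_of_pinnedRowsFine (σ : Plaq (F.P (J + 1)) 0 → ℝ) (hσ : ∀ p, 0 ≤ σ p)
    {B : Set (GaugeField (F.P J) 0 (Matrix.specialUnitaryGroup (Fin 2) ℂ))} (hBJ : B ⊆ {U | PlaqSmall (θ J) U})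
    (hrows : ∀ p : Plaq (F.P (J + 1)) 0,
      gibbsK F ℰp γ (J + 1) (descendTo F ℰp J (J + 1) (Nat.le_succ J) ⁻¹' B ∩ {U | θ (J + 1) ≤ dist1 (GaugeField.plaqHol U p)}) ≤
        ENNReal.ofReal (σ p) *
          gibbsK F ℰp γ (J + 1) (descendTo F ℰp J (J + 1) (Nat.le_succ J) ⁻¹' B ∩ histGood F ℰp θ (J + 1) J)) :
    gibbsK F ℰp γ (J + 1) (descendTo F ℰp J (J + 1) (Nat.le_succ J) ⁻¹' B) ≤
      ENNReal.ofReal (Real.exp (Real.log (1 + ∑ p : Plaq (F.P (J + 1)) 0, σ p))) *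
        gibbsK F ℰp γ (J + 1) (descendTo F ℰp J (J + 1) (Nat.le_succ J) ⁻¹' B ∩ histGood F ℰp θ (J + 1) J) :=
  condGoodOdds_of_regimeCover F γ θ (Nat.le_succ J) Finset.univ (fun p => {U | θ (J + 1) ≤ dist1 (GaugeField.plaqHol U p)}) σ
    (fun p _ => hσ p) (preimage_diff_histGood_subset_fine F θ J hBJ) (fun p _ => hrows p)

/-! ## §2 The profile at depth one, full window: ⟨PINNED-PROFILE₁⟩ ⇒ ✓A's ⟨COND-ODDS₁⟩ ⇒ TAILSUP₁ verbatim -/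

/-- The fine-level profile sum: `Σ_{p∈T_{J+1}} C·β_{J+1}^A·e^{−c·pFun b₀ p₀(g_{J+1})²} ≤ A'·2^{−J}` (✓L `sum_pinnedProfile_le` at `K = J + 1`, `(J, J+1] = {J+1}`).
[cite: Balaban1985UV3, (7) p.257 and (71) p.273] -/
theorem sum_pinnedProfile_fine_le {γ b₀ p₀ : ℝ} (hγ : 0 < γ) (hγ1 : γ ≤ 1) (hb₀ : 0 < b₀) (hp₀ : 1 ≤ p₀) {C : ℝ} (hC : 0 ≤ C) (A : ℕ) {c : ℝ} (hc : 0 < c) :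
    ∑ _p : Plaq (F.P (J + 1)) 0,
        C * (F.scheme ℰp γ).β (J + 1) ^ A * Real.exp (-(c * B10.pFun b₀ p₀ (Real.sqrt (γ * ((F.L : ℝ)⁻¹) ^ (J + 1))) ^ 2)) ≤
      (72 * C * (F.L : ℝ) ^ (3 * F.m) * γ⁻¹ ^ A *
          Real.exp ((((3 : ℝ) + A) * Real.log F.L + Real.log 2) ^ 2 / (4 * (c * b₀ ^ 2 * Real.log F.L ^ 2 / 4)))) *
        ((1 : ℝ) / 2) ^ J := by
  have h := sum_pinnedProfile_le F hγ hγ1 hb₀ hp₀ hC A hc J (J + 1)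
  rwa [Nat.Ioc_succ_singleton, Finset.sum_singleton] at h

/-- ★★★ **⟨PINNED-PROFILE₁⟩ ⇒ ✓A's ⟨COND-ODDS₁⟩ VERBATIM.**  ⟨PINNED-PROFILE₁⟩ (TAILSUP₁'s quantifier prefix, then): there are `C ≥ 0`, `A`, `c > 0` such that for every `J`,
every plaquette `p` of the fine lattice `T_{J+1}` and every measurable `B` inside the height-`J` window,
`Gibbs_{J+1}(D_{J,J+1}⁻¹B ∩ {θBal L γ b₀ p₀ (J+1) ≤ dist1(U(∂p))}) ≤ ofReal(C·β_{J+1}^A·e^{−c·pFun b₀ p₀(g_{J+1})²})·Gibbs_{J+1}(D_{J,J+1}⁻¹B ∩ histGood (θBal L γ b₀ p₀) (J+1) J)`.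
Conclusion: the hypothesis ⟨COND-ODDS₁⟩ of ✓A `windowOddsSupDepthOneCan_of_condGoodOddsDepthOne`, `τ J = A'·2^{−J}` (`pS ↦ max pS 1`, `γ₁ ↦ min γ₁ 1`).
[cite: Balaban1985UV3, (7) p.257, (38)-(40) p.266 and (71) p.273] -/
theorem condGoodOddsDepthOne_of_pinnedProfileFine
    (h : ∀ (L : ℕ), ∃ pS : ℝ, ∀ (b₀ p₀ : ℝ), 0 < b₀ → pS ≤ p₀ → 0 < p₀ →
      ∃ γ₁ : ℝ, 0 < γ₁ ∧ ∀ (F : T3Family) (γ : ℝ), F.L = L → 0 < γ → γ ≤ γ₁ →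
        ∃ (C : ℝ) (A : ℕ) (c : ℝ), 0 ≤ C ∧ 0 < c ∧
          ∀ (J : ℕ) (p : Plaq (F.P (J + 1)) 0) (B : Set (GaugeField (F.P J) 0 (Matrix.specialUnitaryGroup (Fin 2) ℂ))), MeasurableSet B →
            B ⊆ {U | PlaqSmall (θBal F.L γ b₀ p₀ J) U} →
            gibbsK F ℰp γ (J + 1) (descendTo F ℰp J (J + 1) (Nat.le_succ J) ⁻¹' B ∩
                {U | θBal F.L γ b₀ p₀ (J + 1) ≤ dist1 (GaugeField.plaqHol U p)}) ≤
              ENNReal.ofReal (C * (F.scheme ℰp γ).β (J + 1) ^ A *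
                  Real.exp (-(c * B10.pFun b₀ p₀ (Real.sqrt (γ * ((F.L : ℝ)⁻¹) ^ (J + 1))) ^ 2))) *
                gibbsK F ℰp γ (J + 1) (descendTo F ℰp J (J + 1) (Nat.le_succ J) ⁻¹' B ∩ histGood F ℰp (θBal F.L γ b₀ p₀) (J + 1) J)) :
    ∀ (L : ℕ), ∃ pS : ℝ, ∀ (b₀ p₀ : ℝ), 0 < b₀ → pS ≤ p₀ → 0 < p₀ →
      ∃ γ₁ : ℝ, 0 < γ₁ ∧ ∀ (F : T3Family) (γ : ℝ), F.L = L → 0 < γ → γ ≤ γ₁ →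
        ∃ τ : ℕ → ℝ, (∀ J, 0 ≤ τ J) ∧ (∀ a : ℕ, Tendsto (fun J : ℕ => ((J : ℝ) + 1) ^ a * τ J) atTop (𝓝 0)) ∧
          ∀ (J : ℕ) (B : Set (GaugeField (F.P J) 0 (Matrix.specialUnitaryGroup (Fin 2) ℂ))), MeasurableSet B →
            B ⊆ {U | PlaqSmall (θBal F.L γ b₀ p₀ J) U} →
            gibbsK F ℰp γ (J + 1) (descendTo F ℰp J (J + 1) (Nat.le_succ J) ⁻¹' B) ≤
              ENNReal.ofReal (Real.exp (τ J)) *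
                gibbsK F ℰp γ (J + 1) (descendTo F ℰp J (J + 1) (Nat.le_succ J) ⁻¹' B ∩ histGood F ℰp (θBal F.L γ b₀ p₀) (J + 1) J) := by
  intro L
  obtain ⟨pS, hpS⟩ := h L
  refine ⟨max pS 1, fun b₀ p₀ hb₀ hpS' hp₀ => ?_⟩
  have hp₀1 : 1 ≤ p₀ := le_trans (le_max_right pS 1) hpS'
  obtain ⟨γ₁, hγ₁, hγ₁F⟩ := hpS b₀ p₀ hb₀ (le_trans (le_max_left pS 1) hpS') hp₀
  refine ⟨min γ₁ 1, lt_min hγ₁ one_pos, fun F γ hFL hγ hγle => ?_⟩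
  have hγ1 : γ ≤ 1 := le_trans hγle (min_le_right γ₁ 1)
  obtain ⟨C, A, c, hC, hc, hrows⟩ := hγ₁F F γ hFL hγ (le_trans hγle (min_le_left γ₁ 1))
  set A' : ℝ := 72 * C * (F.L : ℝ) ^ (3 * F.m) * γ⁻¹ ^ A *
      Real.exp ((((3 : ℝ) + A) * Real.log F.L + Real.log 2) ^ 2 / (4 * (c * b₀ ^ 2 * Real.log F.L ^ 2 / 4))) with hA'def
  have hA' : 0 ≤ A' := by
    rw [hA'def]
    have hL : (0 : ℝ) ≤ F.L := Nat.cast_nonneg _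
    have : 0 ≤ γ⁻¹ := inv_nonneg.mpr hγ.le
    positivity
  refine ⟨fun J => A' * ((1 : ℝ) / 2) ^ J, fun J => mul_nonneg hA' (pow_nonneg (by norm_num) J),
    fun a => FluctuationComparisonRegPrIntLSupTailModulus.tendsto_pow_mul_geometric a A', ?_⟩
  intro J B hB hBW
  set w : Plaq (F.P (J + 1)) 0 → ℝ := fun _ =>
    C * (F.scheme ℰp γ).β (J + 1) ^ A * Real.exp (-(c * B10.pFun b₀ p₀ (Real.sqrt (γ * ((F.L : ℝ)⁻¹) ^ (J + 1))) ^ 2)) with hwdef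
  have hw : ∀ p, 0 ≤ w p := fun _ =>
    mul_nonneg (mul_nonneg hC (pow_nonneg (F.scheme_β_nonneg ℰp hγ.le (J + 1)) A)) (Real.exp_nonneg _)
  have hmain := condGoodOddsDepthOne_of_pinnedRowsFine F γ (θBal F.L γ b₀ p₀) J w hw hBW (fun p => hrows J p B hB hBW)
  refine hmain.trans (mul_le_mul' (ENNReal.ofReal_le_ofReal (Real.exp_le_exp.mpr ?_)) le_rfl)
  have hS0 : 0 ≤ ∑ p : Plaq (F.P (J + 1)) 0, w p := Finset.sum_nonneg fun p _ => hw p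
  have hlog : Real.log (1 + ∑ p : Plaq (F.P (J + 1)) 0, w p) ≤ ∑ p : Plaq (F.P (J + 1)) 0, w p := by
    rw [Real.log_le_iff_le_exp (by linarith)]
    linarith [Real.add_one_le_exp (∑ p : Plaq (F.P (J + 1)) 0, w p)]
  exact hlog.trans (sum_pinnedProfile_fine_le F J hγ hγ1 hb₀ hp₀1 hC A hc)

/-- ★★★ **⟨PINNED-PROFILE₁⟩ ⇒ TAILSUP₁** (LINE g21-1's row `RunPairOrgan.OneLoop.WindowOddsSupDepthOneCan`, text verbatim): `condGoodOddsDepthOne_of_pinnedProfileFine` then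
✓A `windowOddsSupDepthOneCan_of_condGoodOddsDepthOne`.  HONEST SCOPE: full-window edition — R3-FLIN exposes the full-window MODERATE pinned rows at `L = 3, 5`; the interior
edition §3 is the live one. [cite: Balaban1985UV3, (7) p.257, (38)-(40) p.266 and (71) p.273] -/
theorem windowOddsSupDepthOne_of_pinnedProfileFine
    (h : ∀ (L : ℕ), ∃ pS : ℝ, ∀ (b₀ p₀ : ℝ), 0 < b₀ → pS ≤ p₀ → 0 < p₀ →
      ∃ γ₁ : ℝ, 0 < γ₁ ∧ ∀ (F : T3Family) (γ : ℝ), F.L = L → 0 < γ → γ ≤ γ₁ →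
        ∃ (C : ℝ) (A : ℕ) (c : ℝ), 0 ≤ C ∧ 0 < c ∧
          ∀ (J : ℕ) (p : Plaq (F.P (J + 1)) 0) (B : Set (GaugeField (F.P J) 0 (Matrix.specialUnitaryGroup (Fin 2) ℂ))), MeasurableSet B →
            B ⊆ {U | PlaqSmall (θBal F.L γ b₀ p₀ J) U} →
            gibbsK F ℰp γ (J + 1) (descendTo F ℰp J (J + 1) (Nat.le_succ J) ⁻¹' B ∩
                {U | θBal F.L γ b₀ p₀ (J + 1) ≤ dist1 (GaugeField.plaqHol U p)}) ≤
              ENNReal.ofReal (C * (F.scheme ℰp γ).β (J + 1) ^ A *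
                  Real.exp (-(c * B10.pFun b₀ p₀ (Real.sqrt (γ * ((F.L : ℝ)⁻¹) ^ (J + 1))) ^ 2))) *
                gibbsK F ℰp γ (J + 1) (descendTo F ℰp J (J + 1) (Nat.le_succ J) ⁻¹' B ∩ histGood F ℰp (θBal F.L γ b₀ p₀) (J + 1) J)) :
    ∀ (L : ℕ), ∃ pS : ℝ, ∀ (b₀ p₀ : ℝ), 0 < b₀ → pS ≤ p₀ → 0 < p₀ →
      ∃ γ₁ : ℝ, 0 < γ₁ ∧ ∀ (F : T3Family) (γ : ℝ), F.L = L → 0 < γ → γ ≤ γ₁ →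
        ∃ τ : ℕ → ℝ, (∀ J, 0 ≤ τ J) ∧ (∀ a : ℕ, Tendsto (fun J : ℕ => ((J : ℝ) + 1) ^ a * τ J) atTop (𝓝 0)) ∧
          ∀ (ν : ℕ → (j : ℕ) → Measure (GaugeField (F.P j) 0 (Matrix.specialUnitaryGroup (Fin 2) ℂ))),
            (∀ K, ν K K = T4GenFunBounds.gibbsMeasure (F.P K) ((F.scheme ℰp γ).β K)) →
            (∀ K j, j < K → ν K j = Measure.map (descend F ℰp j) (ν K (j + 1))) →
            ∀ (J : ℕ) (ρ : GaugeField (F.P J) 0 (Matrix.specialUnitaryGroup (Fin 2) ℂ) → ℝ),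
              (∀ U, PlaqSmall (θBal F.L γ b₀ p₀ J) U → 0 < ρ U) →
              ν (J + 1) J = (fieldMeasure _ _ _).withDensity (fun U => ENNReal.ofReal (ρ U)) →
              ContinuousOn ρ {U | PlaqSmall (θBal F.L γ b₀ p₀ J) U} →
              (∀ U : GaugeField (F.P J) 0 (Matrix.specialUnitaryGroup (Fin 2) ℂ), PlaqSmall (θBal F.L γ b₀ p₀ J) U →
                  0 < heightDensityCan F γ (Nat.le_succ J) (histGood F ℰp (θBal F.L γ b₀ p₀) (J + 1) J) U) →
              ∃ c : ℝ, ∀ U : GaugeField (F.P J) 0 (Matrix.specialUnitaryGroup (Fin 2) ℂ), PlaqSmall (θBal F.L γ b₀ p₀ J) U →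
                0 ≤ Real.log (ρ U) - c - Real.log (heightDensityCan F γ (Nat.le_succ J) (histGood F ℰp (θBal F.L γ b₀ p₀) (J + 1) J) U) ∧
                Real.log (ρ U) - c - Real.log (heightDensityCan F γ (Nat.le_succ J) (histGood F ℰp (θBal F.L γ b₀ p₀) (J + 1) J) U) ≤ τ J :=
  FluctuationComparisonRegPrIntLSupTailReduction.windowOddsSupDepthOneCan_of_condGoodOddsDepthOne (condGoodOddsDepthOne_of_pinnedProfileFine h)

end DepthOne

/-! ## §3 The interior window (LINE g21-2 v1.4, after R3-FLIN): ⟨PINNED-PROFILE₁∘⟩ ⇒ ✓K's ⟨COND-ODDS₁∘⟩ ⇒ TAILSUP₁∘ verbatim -/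

section Interior

/-- ★★★ **⟨PINNED-PROFILE₁∘⟩ ⇒ ✓K's ⟨COND-ODDS₁∘⟩ VERBATIM** (window clauses on the INTERIOR window `{PlaqSmall (θBal L γ (c·b₀) p₀ J)}`, `c ∈ (0, c₀]`, `c₀ ≤ 1` chosen after `L`;
history at profile `b₀`).  ⟨PINNED-PROFILE₁∘⟩ (TAILSUP₁∘'s quantifier prefix, then): there are `C ≥ 0`, `A`, `c' > 0` such that for every `J`, every plaquette `p` of `T_{J+1}` and
every measurable `B` inside the INTERIOR height-`J` window, `Gibbs_{J+1}(D⁻¹B ∩ {θBal L γ b₀ p₀ (J+1) ≤ dist1(U(∂p))}) ≤ ofReal(C·β_{J+1}^A·e^{−c'·pFun b₀ p₀(g_{J+1})²})·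
Gibbs_{J+1}(D⁻¹B ∩ histGood (θBal L γ b₀ p₀) (J+1) J)`.  The interior window lies inside the history's level-`J` window (lit `θBal_mul_le`, `c ≤ 1`, `γ ≤ 1`), so §1 applies
with `θ = θBal L γ b₀ p₀`; `τ J = A'·2^{−J}` (`pS ↦ max pS 1`, `γ₁ ↦ min γ₁ 1`). [cite: Balaban1985UV3, (2) p.256, (7) p.257, (38)-(40) p.266 and (71) p.273] -/
theorem condGoodOddsDepthOneInt_of_pinnedProfileFineInt
    (h : ∀ (L : ℕ), ∃ c₀ : ℝ, 0 < c₀ ∧ c₀ ≤ 1 ∧ ∀ (c : ℝ), 0 < c → c ≤ c₀ → ∃ pS : ℝ, ∀ (b₀ p₀ : ℝ), 0 < b₀ → pS ≤ p₀ → 0 < p₀ →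
      ∃ γ₁ : ℝ, 0 < γ₁ ∧ ∀ (F : T3Family) (γ : ℝ), F.L = L → 0 < γ → γ ≤ γ₁ →
        ∃ (C : ℝ) (A : ℕ) (c' : ℝ), 0 ≤ C ∧ 0 < c' ∧
          ∀ (J : ℕ) (p : Plaq (F.P (J + 1)) 0) (B : Set (GaugeField (F.P J) 0 (Matrix.specialUnitaryGroup (Fin 2) ℂ))), MeasurableSet B →
            B ⊆ {U | PlaqSmall (θBal F.L γ (c * b₀) p₀ J) U} →
            gibbsK F ℰp γ (J + 1) (descendTo F ℰp J (J + 1) (Nat.le_succ J) ⁻¹' B ∩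
                {U | θBal F.L γ b₀ p₀ (J + 1) ≤ dist1 (GaugeField.plaqHol U p)}) ≤
              ENNReal.ofReal (C * (F.scheme ℰp γ).β (J + 1) ^ A *
                  Real.exp (-(c' * B10.pFun b₀ p₀ (Real.sqrt (γ * ((F.L : ℝ)⁻¹) ^ (J + 1))) ^ 2))) *
                gibbsK F ℰp γ (J + 1) (descendTo F ℰp J (J + 1) (Nat.le_succ J) ⁻¹' B ∩ histGood F ℰp (θBal F.L γ b₀ p₀) (J + 1) J)) :
    ∀ (L : ℕ), ∃ c₀ : ℝ, 0 < c₀ ∧ c₀ ≤ 1 ∧ ∀ (c : ℝ), 0 < c → c ≤ c₀ → ∃ pS : ℝ, ∀ (b₀ p₀ : ℝ), 0 < b₀ → pS ≤ p₀ → 0 < p₀ →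
      ∃ γ₁ : ℝ, 0 < γ₁ ∧ ∀ (F : T3Family) (γ : ℝ), F.L = L → 0 < γ → γ ≤ γ₁ →
        ∃ τ : ℕ → ℝ, (∀ J, 0 ≤ τ J) ∧ (∀ a : ℕ, Tendsto (fun J : ℕ => ((J : ℝ) + 1) ^ a * τ J) atTop (𝓝 0)) ∧
          ∀ (J : ℕ) (B : Set (GaugeField (F.P J) 0 (Matrix.specialUnitaryGroup (Fin 2) ℂ))), MeasurableSet B →
            B ⊆ {U | PlaqSmall (θBal F.L γ (c * b₀) p₀ J) U} →
            gibbsK F ℰp γ (J + 1) (descendTo F ℰp J (J + 1) (Nat.le_succ J) ⁻¹' B) ≤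
              ENNReal.ofReal (Real.exp (τ J)) *
                gibbsK F ℰp γ (J + 1) (descendTo F ℰp J (J + 1) (Nat.le_succ J) ⁻¹' B ∩ histGood F ℰp (θBal F.L γ b₀ p₀) (J + 1) J) := by
  intro L
  obtain ⟨c₀, hc₀, hc₀1, hc⟩ := h L
  refine ⟨c₀, hc₀, hc₀1, fun c hcpos hcle => ?_⟩
  obtain ⟨pS, hpS⟩ := hc c hcpos hcle
  refine ⟨max pS 1, fun b₀ p₀ hb₀ hpS' hp₀ => ?_⟩
  have hp₀1 : 1 ≤ p₀ := le_trans (le_max_right pS 1) hpS'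
  obtain ⟨γ₁, hγ₁, hγ₁F⟩ := hpS b₀ p₀ hb₀ (le_trans (le_max_left pS 1) hpS') hp₀
  refine ⟨min γ₁ 1, lt_min hγ₁ one_pos, fun F γ hFL hγ hγle => ?_⟩
  have hγ1 : γ ≤ 1 := le_trans hγle (min_le_right γ₁ 1)
  obtain ⟨C, A, c', hC, hc', hrows⟩ := hγ₁F F γ hFL hγ (le_trans hγle (min_le_left γ₁ 1))
  set A' : ℝ := 72 * C * (F.L : ℝ) ^ (3 * F.m) * γ⁻¹ ^ A *
      Real.exp ((((3 : ℝ) + A) * Real.log F.L + Real.log 2) ^ 2 / (4 * (c' * b₀ ^ 2 * Real.log F.L ^ 2 / 4))) with hA'def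
  have hA' : 0 ≤ A' := by
    rw [hA'def]
    have hL : (0 : ℝ) ≤ F.L := Nat.cast_nonneg _
    have : 0 ≤ γ⁻¹ := inv_nonneg.mpr hγ.le
    positivity
  refine ⟨fun J => A' * ((1 : ℝ) / 2) ^ J, fun J => mul_nonneg hA' (pow_nonneg (by norm_num) J),
    fun a => FluctuationComparisonRegPrIntLSupTailModulus.tendsto_pow_mul_geometric a A', ?_⟩
  intro J B hB hBW
  -- the interior window lies inside the history's level-`J` window (`c ≤ c₀ ≤ 1`, `γ ≤ 1`)
  have hBJ : B ⊆ {U : GaugeField (F.P J) 0 (Matrix.specialUnitaryGroup (Fin 2) ℂ) | PlaqSmall (θBal F.L γ b₀ p₀ J) U} := fun U hU =>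
    T3PrintedMinimiserExistence.plaqSmall_of_le
      (T3InteriorExcision.θBal_mul_le (le_of_lt F.hL.2) hγ hγ1 hb₀ (hcle.trans hc₀1) p₀ J) (hBW hU)
  set w : Plaq (F.P (J + 1)) 0 → ℝ := fun _ =>
    C * (F.scheme ℰp γ).β (J + 1) ^ A * Real.exp (-(c' * B10.pFun b₀ p₀ (Real.sqrt (γ * ((F.L : ℝ)⁻¹) ^ (J + 1))) ^ 2)) with hwdef
  have hw : ∀ p, 0 ≤ w p := fun _ =>
    mul_nonneg (mul_nonneg hC (pow_nonneg (F.scheme_β_nonneg ℰp hγ.le (J + 1)) A)) (Real.exp_nonneg _)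
  have hmain := condGoodOddsDepthOne_of_pinnedRowsFine F γ (θBal F.L γ b₀ p₀) J w hw hBJ (fun p => hrows J p B hB hBW)
  refine hmain.trans (mul_le_mul' (ENNReal.ofReal_le_ofReal (Real.exp_le_exp.mpr ?_)) le_rfl)
  have hS0 : 0 ≤ ∑ p : Plaq (F.P (J + 1)) 0, w p := Finset.sum_nonneg fun p _ => hw p
  have hlog : Real.log (1 + ∑ p : Plaq (F.P (J + 1)) 0, w p) ≤ ∑ p : Plaq (F.P (J + 1)) 0, w p := by
    rw [Real.log_le_iff_le_exp (by linarith)]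
    linarith [Real.add_one_le_exp (∑ p : Plaq (F.P (J + 1)) 0, w p)]
  exact hlog.trans (sum_pinnedProfile_fine_le F J hγ hγ1 hb₀ hp₀1 hC A hc')

/-- ★★★ **⟨PINNED-PROFILE₁∘⟩ ⇒ TAILSUP₁∘** (LINE g21-2 v1.4's interior row `RunPairOrgan.OneLoop.WindowOddsSupDepthOneIntCan`, text verbatim — the live edition after R3-FLIN):
`condGoodOddsDepthOneInt_of_pinnedProfileFineInt` then ✓K `windowOddsSupDepthOneIntCan_of_condGoodOddsDepthOneInt`.  HONEST SCOPE: the interior-window fine-level pinned rows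
(PPT∘ moderate + FPT far, per plaquette, with Bałaban's profile weight) are the HYPOTHESIS; nothing upstream is proved here. [cite: Balaban1985UV3, (2) p.256, (7) p.257, (38)-(40) p.266 and (71) p.273] -/
theorem windowOddsSupDepthOneInt_of_pinnedProfileFineInt
    (h : ∀ (L : ℕ), ∃ c₀ : ℝ, 0 < c₀ ∧ c₀ ≤ 1 ∧ ∀ (c : ℝ), 0 < c → c ≤ c₀ → ∃ pS : ℝ, ∀ (b₀ p₀ : ℝ), 0 < b₀ → pS ≤ p₀ → 0 < p₀ →
      ∃ γ₁ : ℝ, 0 < γ₁ ∧ ∀ (F : T3Family) (γ : ℝ), F.L = L → 0 < γ → γ ≤ γ₁ →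
        ∃ (C : ℝ) (A : ℕ) (c' : ℝ), 0 ≤ C ∧ 0 < c' ∧
          ∀ (J : ℕ) (p : Plaq (F.P (J + 1)) 0) (B : Set (GaugeField (F.P J) 0 (Matrix.specialUnitaryGroup (Fin 2) ℂ))), MeasurableSet B →
            B ⊆ {U | PlaqSmall (θBal F.L γ (c * b₀) p₀ J) U} →
            gibbsK F ℰp γ (J + 1) (descendTo F ℰp J (J + 1) (Nat.le_succ J) ⁻¹' B ∩
                {U | θBal F.L γ b₀ p₀ (J + 1) ≤ dist1 (GaugeField.plaqHol U p)}) ≤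
              ENNReal.ofReal (C * (F.scheme ℰp γ).β (J + 1) ^ A *
                  Real.exp (-(c' * B10.pFun b₀ p₀ (Real.sqrt (γ * ((F.L : ℝ)⁻¹) ^ (J + 1))) ^ 2))) *
                gibbsK F ℰp γ (J + 1) (descendTo F ℰp J (J + 1) (Nat.le_succ J) ⁻¹' B ∩ histGood F ℰp (θBal F.L γ b₀ p₀) (J + 1) J)) :
    ∀ (L : ℕ), ∃ c₀ : ℝ, 0 < c₀ ∧ c₀ ≤ 1 ∧ ∀ (c : ℝ), 0 < c → c ≤ c₀ → ∃ pS : ℝ, ∀ (b₀ p₀ : ℝ), 0 < b₀ → pS ≤ p₀ → 0 < p₀ →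
    ∃ γ₁ : ℝ, 0 < γ₁ ∧ ∀ (F : T3Family) (γ : ℝ), F.L = L → 0 < γ → γ ≤ γ₁ →
      ∃ τ : ℕ → ℝ, (∀ J, 0 ≤ τ J) ∧ (∀ a : ℕ, Tendsto (fun J : ℕ => ((J : ℝ) + 1) ^ a * τ J) atTop (𝓝 0)) ∧
        ∀ (ν : ℕ → (j : ℕ) → Measure (GaugeField (F.P j) 0 (Matrix.specialUnitaryGroup (Fin 2) ℂ))),
          (∀ K, ν K K = T4GenFunBounds.gibbsMeasure (F.P K) ((F.scheme ℰp γ).β K)) →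
          (∀ K j, j < K → ν K j = Measure.map (descend F ℰp j) (ν K (j + 1))) →
          ∀ (J : ℕ) (ρ : GaugeField (F.P J) 0 (Matrix.specialUnitaryGroup (Fin 2) ℂ) → ℝ),
            (∀ U, PlaqSmall (θBal F.L γ (c * b₀) p₀ J) U → 0 < ρ U) →
            ν (J + 1) J = (fieldMeasure _ _ _).withDensity (fun U => ENNReal.ofReal (ρ U)) →
            ContinuousOn ρ {U | PlaqSmall (θBal F.L γ (c * b₀) p₀ J) U} →
            (∀ U : GaugeField (F.P J) 0 (Matrix.specialUnitaryGroup (Fin 2) ℂ), PlaqSmall (θBal F.L γ (c * b₀) p₀ J) U →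
                0 < heightDensityCan F γ (Nat.le_succ J) (histGood F ℰp (θBal F.L γ b₀ p₀) (J + 1) J) U) →
            ∃ a₀ : ℝ, ∀ U : GaugeField (F.P J) 0 (Matrix.specialUnitaryGroup (Fin 2) ℂ), PlaqSmall (θBal F.L γ (c * b₀) p₀ J) U →
              0 ≤ Real.log (ρ U) - a₀ - Real.log (heightDensityCan F γ (Nat.le_succ J) (histGood F ℰp (θBal F.L γ b₀ p₀) (J + 1) J) U) ∧
              Real.log (ρ U) - a₀ - Real.log (heightDensityCan F γ (Nat.le_succ J) (histGood F ℰp (θBal F.L γ b₀ p₀) (J + 1) J) U) ≤ τ J :=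
  FluctuationComparisonRegPrIntLSupTailReductionInt.windowOddsSupDepthOneIntCan_of_condGoodOddsDepthOneInt
    (condGoodOddsDepthOneInt_of_pinnedProfileFineInt h)

end Interior

end Summit.QuantumFields.YangMills.Theorems.FluctuationComparisonRegPrIntLSupTailCoverUnionDepthOne

end
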